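import Summits.BirchSwinnertonDyer.BirchSwinnertonDyer.Theorems.ManinLocalTwoThreeDeltaHomDiamond
import Summits.BirchSwinnertonDyer.BirchSwinnertonDyer.Theorems.ManinLocalTwoThreeThreeShiftGlue
import Literature.NumberTheory.EllipticCurves.Gamma0AwayPairExtension
import HarnessLib

/-!
# RIGIDITY OF SHIFT-COMPATIBLE PAIRS mod `p` at level prime to `p` — the base of the equaliser chain for EVERY prime
# (route `ManinLocalTwoThree`, cell bsd-f2-manin; seat `bsd-line-manin23-p2` gen 12; bears on C2 stmt-…-22967 (t = 2 base) and C3 22968)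

For a prime `p`, a level `N ≥ 1` with `p ∤ N`, and an abelian group `K` killed by `p` (e.g. `K = ℤ/p`): if two additive maps
`φ₁, φ₂ : Γ₀(N) → K` are COMPATIBLE along the two embeddings of `Γ₀(Np)` — `φ₁(γ) = φ₂(diag(p,1) γ diag(p,1)⁻¹)` for every
`γ ∈ Γ₀(Np)`, i.e. `φ₁(a b; pc d) = φ₂(a pb; c d)` — then **`φ₁ = φ₂` and both are DIAMOND characters** (vanish on `Γ₁(N)`,
i.e. factor through `d mod N`): `shiftCompatiblePair_eq`, `shiftCompatiblePair_diamond`.  In particular (`φ₂ = φ₁`) every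
`p`-shift-invariant additive character `Γ₀(N) → K` is diamond — the `p`-generic form of the es chain's base E-es-102
`ThreeShiftBasePrimeToThree` (`p = 3`; there the second half `K₃⁻(N) = 0` is the pair `(ψ, −ψ)`: `ψ = −ψ`) — and at
`p = 2` it is the BASE of a would-be 2-adic twin of E-es-94♯ (`twoShiftInvariant_isDiamond`).

PROOF (no new idea — the cell's t = 3 proof, run at any prime): Serre's amalgam in Hom-form for a compatible pair
(`Literature…Gamma0Away.exists_extension_of_compatible_pair`, every prime) gives `Φ : SL₂(ℤ[1/p]) → K` additive on
`Δ_p(N)` with `Φ ∘ ι = φ₁`, `Φ ∘ θ ∘ ι = φ₂`; `Φ` kills the unipotents because `U(x) = U(x/p)^p` and `p·K = 0` (the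
"`p`-th root trick"); by the tree's Vaserstein diamond bottom (`deltaHom_eq_of_sub_mem_span`, `exists_diamond_of_deltaHom`)
`Φ(g)` depends only on `d_g mod N`, and `ι γ`, `θ(ι γ)` have the same `d` — so `φ₁ = φ₂` — and is a diamond function.
Nothing about BSD or Manin's conjecture is proved here; C2/C3 stay OPEN.
-/

set_option linter.dupNamespace false

noncomputable section

open scoped MatrixGroups
open CongruenceSubgroup
open Literature.NumberTheory.Automorphic (SL2Rel.e12_add SL2Rel.e21_add SL2Rel.e12_zero SL2Rel.e21_zero SL2Rel.e12 SL2Rel.e21)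
open Summit.BirchSwinnertonDyer.BirchSwinnertonDyer.Theorems.ManinLocalTwoThree.ThreeShiftDescent (addOn_map_zpow)
open Literature.NumberTheory.EllipticCurves (Gamma0Away.theta Gamma0Away.thetaAux Gamma0Away.theta_apply
  Gamma0Away.exists_extension_of_compatible_pair)
open Literature.NumberTheory.EllipticCurves.ModularForms (Gamma0.degeneracyConj)
open Summit.BirchSwinnertonDyer.BirchSwinnertonDyer.Theorems.ConjSpanGenAllLevels (Away iota upperUnip lowerUnip Delta
  iota_apply)

namespace Summit.BirchSwinnertonDyer.BirchSwinnertonDyer.Theorems.ManinLocalTwoThree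

section PthRoot

/-- `E₁₂(n·y) = E₁₂(y)ⁿ`. [folklore] -/
theorem e12_nsmul {R : Type*} [CommRing R] (y : R) (n : ℕ) : SL2Rel.e12 (n • y) = SL2Rel.e12 y ^ n := by
  induction n with
  | zero => rw [zero_nsmul, pow_zero, SL2Rel.e12_zero]
  | succ n ih => rw [succ_nsmul, SL2Rel.e12_add, ih, pow_succ]

/-- `E₂₁(n·y) = E₂₁(y)ⁿ`. [folklore] -/
theorem e21_nsmul {R : Type*} [CommRing R] (y : R) (n : ℕ) : SL2Rel.e21 (n • y) = SL2Rel.e21 y ^ n := by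
  induction n with
  | zero => rw [zero_nsmul, pow_zero, SL2Rel.e21_zero]
  | succ n ih => rw [succ_nsmul, SL2Rel.e21_add, ih, pow_succ]

variable {p N : ℕ} {K : Type*} [AddCommGroup K] (Φ : SL(2, Away p) → K)
  (hadd : ∀ g ∈ Delta p N, ∀ g' ∈ Delta p N, Φ (g * g') = Φ g + Φ g') (hK : ∀ k : K, p • k = 0)

include hadd hK

/-- The `p`-th root trick, upper: `Φ(U⁺(x)) = 0` since `U⁺(x) = U⁺(x/p)^p` and `p·K = 0`. [folklore] -/
theorem deltaHom_upperUnip_eq_zero_of_torsion (x : Away p) : Φ (upperUnip x) = 0 := by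
  set y : Away p := x * IsLocalization.Away.invSelf (S := Away p) (p : ℤ) with hy
  have hpy : (p : Away p) * y = x := by
    have h := IsLocalization.Away.mul_invSelf (S := Away p) (p : ℤ)
    rw [hy, mul_left_comm, show (p : Away p) = algebraMap ℤ (Away p) (p : ℤ) by simp, h, mul_one]
  have hpow : upperUnip x = (upperUnip y) ^ p := by
    rw [← hpy, upperUnip_eq_e12, upperUnip_eq_e12, ← nsmul_eq_mul, e12_nsmul]
  rw [hpow, ← zpow_natCast, addOn_map_zpow hadd (upperUnip_mem_Delta y), natCast_zsmul]
  exact hK _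

/-- The `p`-th root trick, lower: `Φ(U⁻(Ny)) = 0`. [folklore] -/
theorem deltaHom_lowerUnip_eq_zero_of_torsion (y : Away p) :
    Φ (lowerUnip ((N : Away p) * y)) = 0 := by
  set z : Away p := y * IsLocalization.Away.invSelf (S := Away p) (p : ℤ) with hz
  have hpz : (p : Away p) * ((N : Away p) * z) = (N : Away p) * y := by
    have h := IsLocalization.Away.mul_invSelf (S := Away p) (p : ℤ)
    rw [hz, show (p : Away p) * ((N : Away p) * (y * _)) = (N : Away p) * y * ((algebraMap ℤ (Away p) (p : ℤ)) *
      IsLocalization.Away.invSelf (S := Away p) (p : ℤ)) by simp; ring, h, mul_one]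
  have hpow : lowerUnip ((N : Away p) * y) = (lowerUnip ((N : Away p) * z)) ^ p := by
    rw [← hpz, lowerUnip_eq_e21, lowerUnip_eq_e21, ← nsmul_eq_mul, e21_nsmul]
  rw [hpow, ← zpow_natCast, addOn_map_zpow hadd (lowerUnip_mul_mem_Delta z), natCast_zsmul]
  exact hK _

end PthRoot

section Rigidity

variable {p : ℕ} (hp : p.Prime) {N : ℕ} (hN : 0 < N) (hpN : ¬ p ∣ N)
  {K : Type} [AddCommGroup K] (hK : ∀ k : K, p • k = 0)
  (φ₁ φ₂ : Gamma0 N → K)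
  (h₁ : ∀ γ δ : Gamma0 N, φ₁ (γ * δ) = φ₁ γ + φ₁ δ) (h₂ : ∀ γ δ : Gamma0 N, φ₂ (γ * δ) = φ₂ γ + φ₂ δ)
  (hcompat : haveI : NeZero p := ⟨hp.ne_zero⟩
    ∀ γ : Gamma0 (N * p),
      φ₁ (Gamma0.degeneracyConj N (N * p) 1 (mul_dvd_mul_left N (one_dvd p)) γ) =
        φ₂ (Gamma0.degeneracyConj N (N * p) p dvd_rfl γ))

include hp hN hpN hK h₁ h₂ hcompat

/-- The common extension `Φ` of a compatible pair kills the unipotents and is therefore constant on `d`-classes;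
packaged: `φ₁ = φ₂` AND `φ₁(ι γ)` depends only on `d_γ mod N` with an `η` additive on units. [folklore] -/
theorem shiftCompatiblePair_exists_diamond :
    (∀ γ : Gamma0 N, φ₁ γ = φ₂ γ) ∧
      ∃ η : ZMod N → K, (∀ a b : ZMod N, IsUnit a → IsUnit b → η (a * b) = η a + η b) ∧
        ∀ γ : Gamma0 N, φ₁ γ = η ((((γ : SL(2, ℤ)) 1 1 : ℤ) : ZMod N)) := by
  haveI : NeZero N := ⟨hN.ne'⟩
  have ht : 2 ≤ p := hp.two_le
  obtain ⟨Φ, hΦ, hι, hθ⟩ := Gamma0Away.exists_extension_of_compatible_pair p hp N hpN K φ₁ φ₂ h₁ h₂ hcompat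
  -- `Φ` is additive on `Delta p N` (definitionally the Literature's membership predicate)
  have hadd : ∀ g ∈ Delta p N, ∀ g' ∈ Delta p N, Φ (g * g') = Φ g + Φ g' :=
    fun g hg g' hg' => hΦ g hg g' hg'
  have hU := deltaHom_upperUnip_eq_zero_of_torsion Φ hadd hK
  have hL := deltaHom_lowerUnip_eq_zero_of_torsion (N := N) Φ hadd hK
  refine ⟨fun γ => ?_, ?_⟩
  · -- `ι γ` and `θ(ι γ)` lie in `Δ` and have the same `d`
    have hιm : iota p (γ : SL(2, ℤ)) ∈ Delta p N := iota_mem_Delta γ.2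
    have hθm : Gamma0Away.theta p (iota p (γ : SL(2, ℤ))) ∈ Delta p N := by
      obtain ⟨s, hs⟩ := hιm
      refine ⟨(p : Away p) * s, ?_⟩
      rw [Gamma0Away.theta_apply]
      show (p : Away p) * (iota p (γ : SL(2, ℤ))) 1 0 = _
      rw [hs]; ring
    have heq := deltaHom_eq_of_sub_mem_span Φ hadd hU hL ht (NeZero.ne N) hιm hθm
      (by rw [Gamma0Away.theta_apply]; show (iota p (γ : SL(2, ℤ))) 1 1 - (iota p (γ : SL(2, ℤ))) 1 1 ∈ _; simp)
    rw [← hι γ, ← hθ γ]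
    exact heq.symm
  · obtain ⟨η, hη, hd⟩ := exists_diamond_of_deltaHom_of_dvd Φ hadd hU hL ht (dvd_refl N)
    exact ⟨η, hη, fun γ => by rw [← hι γ]; exact hd γ⟩

/-- **RIGIDITY, first half: a compatible pair is EQUAL** (`φ₁ = φ₂` on `Γ₀(N)`). [folklore] -/
theorem shiftCompatiblePair_eq (γ : Gamma0 N) : φ₁ γ = φ₂ γ :=
  (shiftCompatiblePair_exists_diamond hp hN hpN hK φ₁ φ₂ h₁ h₂ hcompat).1 γ

/-- **RIGIDITY, second half: a compatible pair is DIAMOND** — `φ₁` vanishes on `Γ₁(N)`. [folklore] -/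
theorem shiftCompatiblePair_diamond (γ : SL(2, ℤ)) (hγ : γ ∈ Gamma1 N) :
    φ₁ ⟨γ, Gamma1_in_Gamma0 N hγ⟩ = 0 := by
  obtain ⟨-, η, hη, hd⟩ := shiftCompatiblePair_exists_diamond hp hN hpN hK φ₁ φ₂ h₁ h₂ hcompat
  haveI : NeZero N := ⟨hN.ne'⟩
  have hη1 : η 1 = 0 := by
    have h := hη 1 1 isUnit_one isUnit_one
    rw [one_mul] at h
    -- `η 1 = η 1 + η 1`
    have : η 1 + η 1 = η 1 + 0 := by rw [add_zero]; exact h.symm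
    exact add_left_cancel this
  have h1 : (((γ 1 1 : ℤ) : ZMod N)) = 1 := ((Gamma1_mem N γ).1 hγ).2.1
  rw [hd]
  show η ((((γ : SL(2, ℤ)) 1 1 : ℤ) : ZMod N)) = 0
  rw [h1, hη1]

end Rigidity

/-! ### Instances: shift-invariant characters are diamond at every prime; the case `p = 2` -/

/-- **`p`-SHIFT-INVARIANT ⟹ DIAMOND, every prime `p ∤ N`** (`K` killed by `p`): an additive `φ : Γ₀(N) → K` with
`φ(γ) = φ(diag(p,1) γ diag(p,1)⁻¹)` for all `γ ∈ Γ₀(Np)` vanishes on `Γ₁(N)` — Ihara's lemma with trivial mod-`p`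
coefficients at level prime to `p`, Eisenstein part included (the `p`-generic form of E-es-102's first half). [folklore] -/
theorem shiftInvariant_isDiamond {p : ℕ} (hp : p.Prime) {N : ℕ} (hN : 0 < N) (hpN : ¬ p ∣ N)
    {K : Type} [AddCommGroup K] (hK : ∀ k : K, p • k = 0) (φ : Gamma0 N → K)
    (hadd : ∀ γ δ : Gamma0 N, φ (γ * δ) = φ γ + φ δ)
    (hinv : haveI : NeZero p := ⟨hp.ne_zero⟩
      ∀ γ : Gamma0 (N * p),
        φ (Gamma0.degeneracyConj N (N * p) 1 (mul_dvd_mul_left N (one_dvd p)) γ) =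
          φ (Gamma0.degeneracyConj N (N * p) p dvd_rfl γ))
    (γ : SL(2, ℤ)) (hγ : γ ∈ Gamma1 N) : φ ⟨γ, Gamma1_in_Gamma0 N hγ⟩ = 0 :=
  shiftCompatiblePair_diamond hp hN hpN hK φ φ hadd hadd hinv γ hγ

/-- **The `t = 2` BASE**: for odd `N ≥ 1`, every additive `φ : Γ₀(N) → ℤ/2` invariant under the 2-shift
`γ ↦ diag(2,1) γ diag(2,1)⁻¹` on `Γ₀(2N)` is a diamond character (vanishes on `Γ₁(N)`) — the base a 2-adic twin of the
nine-shift equaliser chain would start from. [folklore] -/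
theorem twoShiftInvariant_isDiamond {N : ℕ} (hN : 0 < N) (h2N : ¬ 2 ∣ N) (φ : Gamma0 N → ZMod 2)
    (hadd : ∀ γ δ : Gamma0 N, φ (γ * δ) = φ γ + φ δ)
    (hinv : ∀ γ : Gamma0 (N * 2),
        φ (Gamma0.degeneracyConj N (N * 2) 1 (mul_dvd_mul_left N (one_dvd 2)) γ) =
          φ (Gamma0.degeneracyConj N (N * 2) 2 dvd_rfl γ))
    (γ : SL(2, ℤ)) (hγ : γ ∈ Gamma1 N) : φ ⟨γ, Gamma1_in_Gamma0 N hγ⟩ = 0 :=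
  shiftInvariant_isDiamond Nat.prime_two hN h2N (fun k => by
    rw [show (2 : ℕ) • k = k + k from two_nsmul k]; exact ZModModule.add_self k) φ hadd hinv γ hγ

/-- **Eigen-characters with eigenvalue `≠ 1` vanish** (`K = ℤ/p`): if `φ(diag(p,1)γdiag(p,1)⁻¹) = ζ · φ(γ)` on
`Γ₀(Np)` with `ζ ≠ 1`, then `φ = 0` — for `p = 3`, `ζ = −1` this is E-es-102's second half `K₃⁻(N) = 0`.
[folklore] -/
theorem shiftEigen_eq_zero {p : ℕ} (hp : p.Prime) {N : ℕ} (hN : 0 < N) (hpN : ¬ p ∣ N)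
    (ζ : ZMod p) (hζ : ζ ≠ 1) (φ : Gamma0 N → ZMod p)
    (hadd : ∀ γ δ : Gamma0 N, φ (γ * δ) = φ γ + φ δ)
    (heig : haveI : NeZero p := ⟨hp.ne_zero⟩
      ∀ γ : Gamma0 (N * p),
        φ (Gamma0.degeneracyConj N (N * p) p dvd_rfl γ) =
          ζ * φ (Gamma0.degeneracyConj N (N * p) 1 (mul_dvd_mul_left N (one_dvd p)) γ))
    (γ : Gamma0 N) : φ γ = 0 := by
  haveI : Fact p.Prime := ⟨hp⟩
  have hK : ∀ k : ZMod p, p • k = 0 := fun k => by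
    rw [nsmul_eq_mul, ZMod.natCast_self, zero_mul]
  have hadd' : ∀ γ δ : Gamma0 N, (fun g => ζ * φ g) (γ * δ) = (fun g => ζ * φ g) γ + (fun g => ζ * φ g) δ :=
    fun γ δ => by simp only [hadd γ δ, mul_add]
  have h := shiftCompatiblePair_eq hp hN hpN hK (fun g => ζ * φ g) φ hadd' hadd (fun γ' => (heig γ').symm) γ
  -- `ζ φ γ = φ γ` with `ζ ≠ 1`
  have h' : (1 - ζ) * φ γ = 0 := by rw [sub_mul, one_mul, sub_eq_zero]; exact h.symm
  rcases mul_eq_zero.mp h' with h0 | h0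
  · exact absurd (sub_eq_zero.mp h0).symm hζ
  · exact h0

end Summit.BirchSwinnertonDyer.BirchSwinnertonDyer.Theorems.ManinLocalTwoThree

end
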